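import Summits.PneNP.PneNP.Theorems.ConstantBand.Negative.LoadBearing
import Literature.Computability.Complexity.RossmanMonotoneCliqueGraphs

/-!
# Route OneSlice, crux `ConstantBand` (stmt-PneNP-2834), line `flat-prior-relative-minterms`:
# toolkit for the relative-minterm stub S3 (`stub_relMintermStep`)

Helper lemmas (prefix `rms_`) for `Theorems/OneSliceConstantBandRelMintermStep.lean`
(`stub_relMintermStep : NearCliqueContiguity → RelMintermPlanted`), stated over the landed vocabulary of
`Theorems/ConstantBand/Negative/LoadBearing.lean` (`Edge`, `slice`) and the Literature clique API only — the
line's counting fractions `sliceProb`/`pairProb`/`tripleProb`, the sub-planting `plantSub A e x` and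
`IsRelMinterm` appear here UNFOLDED (`x ∪ (K_A − e) = fun e' => x e' || (cliqueVec A e' && decide (e' ≠ e))`),
so that this file does not depend on the vocabulary module:

* the key combinatorial lemma `rms_relMinterm_of_good`: for monotone `f`, if `f(x ∪ K_A) = 1` and every
  maximal proper sub-planting `x ∪ (K_A − e)` (`e ∈ K_A`) is rejected, then every `y` with `x ≤ y < x ∪ K_A`
  is rejected (`K_A` is a relative minterm of `f` at `x`);
* counting on `slice_i × (k-sets) × edges`: `#(edgesIn A) = C(|A|,2)`, marginals (`rms_card_filter_fst`,
  `rms_card_filter_triple`), the union-bound shadow `rms_card_filter_exists_le`, covers and differences;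
* the "flat prior" telescoping bound `Σ_{i ∈ [L,U]} (a(i+s) − a(i)) ≤ s` for `a : ℕ → [0,1]`, the band
  interval bookkeeping, and the final real-arithmetic assembly `rms_assemble`.

Pure finite counting; no circuits, no probability beyond counting fractions.
-/

set_option linter.dupNamespace false

namespace Summit.PneNP.PneNP.Cruxes.ConstantBand.FlatPriorRelativeMinterms

open Literature.Computability.Complexity Filter Classical
open Finset hiding slice
open Summit.PneNP.PneNP.Theorems.ConstantBand.Negative

variable {n : ℕ}

/-! ## Planting combinatorics -/

/-- `K_A` has exactly `C(|A|,2)` potential edges inside `A`. [folklore] -/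
theorem rms_card_edgesIn (A : Finset (Fin n)) : #(edgesIn A) = (#A).choose 2 := by
  rw [← card_filter_cliqueVec A, edgesIn]
  congr 1
  ext e
  simp only [mem_filter, mem_univ, true_and, cliqueVec_eq_true_iff_endpts]

/-- `x ≤ x ∪ (K_A − e)` (the sub-planting, unfolded). [folklore] -/
theorem rms_le_plantSub (A : Finset (Fin n)) (e : Edge n) (x : Edge n → Bool) :
    x ≤ fun e' => x e' || (cliqueVec A e' && decide (e' ≠ e)) := by
  intro e'
  show x e' ≤ (x e' || _)
  cases x e' <;> simp

/-- `x ∪ (K_A − e) ≤ x ∪ K_A`. [folklore] -/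
theorem rms_plantSub_le_plantClique (A : Finset (Fin n)) (e : Edge n) (x : Edge n → Bool) :
    (fun e' => x e' || (cliqueVec A e' && decide (e' ≠ e))) ≤ plantClique A x := by
  intro e'
  show (x e' || _) ≤ (x e' || cliqueVec A e')
  cases x e' <;> cases cliqueVec A e' <;> simp

/-- **Key combinatorial lemma** (relative minterms from rejected maximal sub-plantings). For a monotone `f`:
if `f(x ∪ K_A) = 1` and `f(x ∪ (K_A − e)) = 0` for every edge `e` of `K_A`, then every `y` with
`x ≤ y ≤ x ∪ K_A`, `y ≠ x ∪ K_A` has `f(y) = 0` — such a `y` misses an edge `e ∈ K_A ∖ x` and lies below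
`x ∪ (K_A − e)`. [folklore] -/
theorem rms_relMinterm_of_good {f : (Edge n → Bool) → Bool} (hf : Monotone f) {x : Edge n → Bool}
    {A : Finset (Fin n)}
    (h2 : ∀ e ∈ edgesIn A, f (fun e' => x e' || (cliqueVec A e' && decide (e' ≠ e))) = false)
    {y : Edge n → Bool} (hxy : x ≤ y) (hyp : y ≤ plantClique A x) (hne : y ≠ plantClique A x) :
    f y = false := by
  obtain ⟨e, he⟩ := Function.ne_iff.1 hne
  have hple := hyp e
  have hye : y e = false := by
    by_contra hy
    rw [Bool.not_eq_false] at hy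
    exact he (by rw [hy, Bool.le_iff_imp.1 hple hy])
  have hpe : plantClique A x e = true := by
    by_contra hp
    rw [Bool.not_eq_true] at hp
    exact he (hye.trans hp.symm)
  have hxe : x e = false := by
    by_contra hx
    have h := Bool.le_iff_imp.1 (hxy e) (by simpa using hx)
    rw [hye] at h
    exact Bool.false_ne_true h
  have heA : e ∈ edgesIn A := by
    rw [edgesIn, mem_filter, ← cliqueVec_eq_true_iff_endpts]
    have : (x e || cliqueVec A e) = true := hpe
    simpa [hxe] using this
  have hle : y ≤ fun e' => x e' || (cliqueVec A e' && decide (e' ≠ e)) := by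
    intro e'
    by_cases hee : e' = e
    · rw [hee, hye]; exact Bool.false_le _
    · simpa [plantClique, hee] using hyp e'
  have hfy := hf hle
  rw [h2 e heA] at hfy
  by_contra hfy'
  rw [Bool.not_eq_false] at hfy'
  exact Bool.false_ne_true (Bool.le_iff_imp.1 hfy hfy')

/-! ## Counting on `slice × k-sets × edges` -/

/-- Monotone events have monotone counts. [folklore] -/
theorem rms_card_filter_mono {α : Type*} {S : Finset α} {P Q : α → Prop} [DecidablePred P]
    [DecidablePred Q] (h : ∀ a, P a → Q a) : #(S.filter P) ≤ #(S.filter Q) :=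
  card_le_card fun a ha => by
    rw [mem_filter] at ha ⊢; exact ⟨ha.1, h _ ha.2⟩

/-- A three-way cover bounds the count by the sum of the three counts. [folklore] -/
theorem rms_card_filter_cover3 {α : Type*} {S : Finset α} {P Q₁ Q₂ Q₃ : α → Prop} [DecidablePred P]
    [DecidablePred Q₁] [DecidablePred Q₂] [DecidablePred Q₃] (h : ∀ a, P a → Q₁ a ∨ Q₂ a ∨ Q₃ a) :
    #(S.filter P) ≤ #(S.filter Q₁) + #(S.filter Q₂) + #(S.filter Q₃) :=
  calc #(S.filter P) ≤ #(S.filter Q₁ ∪ S.filter Q₂ ∪ S.filter Q₃) := by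
        refine card_le_card fun a ha => ?_
        rw [mem_filter] at ha
        simp only [mem_union, mem_filter]
        have := h _ ha.2
        tauto
    _ ≤ #(S.filter Q₁ ∪ S.filter Q₂) + #(S.filter Q₃) := card_union_le _ _
    _ ≤ _ := Nat.add_le_add_right (card_union_le _ _) _

/-- Difference rule for nested events under a common side condition `E`:
`#(E ∧ Q ∧ ¬P) + #(E ∧ P) = #(E ∧ Q)` when `P ⇒ Q`. [folklore] -/
theorem rms_card_filter_and_not {α : Type*} {S : Finset α} {E P Q : α → Prop} [DecidablePred E]
    [DecidablePred P] [DecidablePred Q] (h : ∀ a, P a → Q a) :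
    #(S.filter fun a => E a ∧ (Q a ∧ ¬ P a)) + #(S.filter fun a => E a ∧ P a) =
      #(S.filter fun a => E a ∧ Q a) := by
  rw [← card_union_of_disjoint]
  · congr 1
    ext a
    simp only [mem_union, mem_filter]
    have := h a
    tauto
  · exact disjoint_filter.2 fun a _ h1 h2 => h1.2.2 h2.2

/-- Marginal on `x`: an event of `x` alone is counted `C(n,k)` times on `slice_i × (k-sets)`. [folklore] -/
theorem rms_card_filter_fst (n k i : ℕ) (Q : (Edge n → Bool) → Prop) [DecidablePred Q] :
    #((slice n i ×ˢ powersetCard k (univ : Finset (Fin n))).filter fun xa => Q xa.1) =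
      #((slice n i).filter Q) * n.choose k := by
  have hset : ((slice n i ×ˢ powersetCard k (univ : Finset (Fin n))).filter fun xa => Q xa.1) =
      (slice n i).filter Q ×ˢ powersetCard k (univ : Finset (Fin n)) := by
    ext xa
    simp only [mem_filter, mem_product]
    tauto
  rw [hset, card_product, card_powersetCard, card_univ, Fintype.card_fin]

/-- Fibre count: over each pair `(x, A)` with `#A = k` there are exactly `C(k,2)` edges of `K_A`, so an
event of `(x, A)` alone is counted `C(k,2)` times on the triples. [folklore] -/
theorem rms_card_filter_triple (n k i : ℕ) (Q : (Edge n → Bool) → Finset (Fin n) → Prop)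
    [∀ x A, Decidable (Q x A)] :
    #(((slice n i ×ˢ powersetCard k (univ : Finset (Fin n))) ×ˢ (univ : Finset (Edge n))).filter
        fun t => t.2 ∈ edgesIn t.1.2 ∧ Q t.1.1 t.1.2) =
      #((slice n i ×ˢ powersetCard k (univ : Finset (Fin n))).filter fun xa => Q xa.1 xa.2) *
        k.choose 2 := by
  rw [card_filter, sum_product, card_filter, sum_mul]
  refine sum_congr rfl fun xa hxa => ?_
  have hA : #xa.2 = k := (mem_powersetCard.1 (mem_product.1 hxa).2).2
  by_cases hq : Q xa.1 xa.2
  · simp only [hq, and_true, sum_boole, Nat.cast_id, ite_true, one_mul]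
    rw [filter_mem_eq_inter, univ_inter, rms_card_edgesIn, hA]
  · simp [hq]

/-- **Union-bound shadow**: a pair `(x, A)` with a witness edge `e ∈ K_A` is the projection of a triple.
[folklore] -/
theorem rms_card_filter_exists_le (Q : (Edge n → Bool) → Finset (Fin n) → Edge n → Prop)
    [∀ x A e, Decidable (Q x A e)] (s : Finset ((Edge n → Bool) × Finset (Fin n))) :
    #(s.filter fun xa => ∃ e ∈ edgesIn xa.2, Q xa.1 xa.2 e) ≤
      #((s ×ˢ (univ : Finset (Edge n))).filter
        fun t => t.2 ∈ edgesIn t.1.2 ∧ Q t.1.1 t.1.2 t.2) := by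
  calc #(s.filter fun xa => ∃ e ∈ edgesIn xa.2, Q xa.1 xa.2 e)
      ≤ #(((s ×ˢ (univ : Finset (Edge n))).filter
            fun t => t.2 ∈ edgesIn t.1.2 ∧ Q t.1.1 t.1.2 t.2).image Prod.fst) := by
        refine card_le_card fun xa hxa => ?_
        rw [mem_filter] at hxa
        obtain ⟨hs, e, he, hq⟩ := hxa
        exact mem_image.2 ⟨(xa, e), mem_filter.2 ⟨mem_product.2 ⟨hs, mem_univ _⟩, he, hq⟩, rfl⟩
    _ ≤ _ := card_image_le

/-- Real form of the union bound: `#shadow / D ≤ C(k,2) · (#triples / (D · C(k,2)))` (`k ≥ 2`). [folklore] -/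
theorem rms_shadow_div_le {k : ℕ} (hk : 2 ≤ k) (Q : (Edge n → Bool) → Finset (Fin n) → Edge n → Prop)
    [∀ x A e, Decidable (Q x A e)] (s : Finset ((Edge n → Bool) × Finset (Fin n))) (D : ℝ)
    (hD : 0 ≤ D) :
    (#(s.filter fun xa => ∃ e ∈ edgesIn xa.2, Q xa.1 xa.2 e) : ℝ) / D ≤
      (k.choose 2 : ℝ) * ((#((s ×ˢ (univ : Finset (Edge n))).filter
        fun t => t.2 ∈ edgesIn t.1.2 ∧ Q t.1.1 t.1.2 t.2) : ℝ) / (D * (k.choose 2 : ℝ))) := by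
  have hK : ((k.choose 2 : ℕ) : ℝ) ≠ 0 := by exact_mod_cast (Nat.choose_pos hk).ne'
  rw [← mul_div_assoc, mul_comm D _, mul_div_mul_left _ _ hK]
  exact div_le_div_of_nonneg_right (by exact_mod_cast rms_card_filter_exists_le Q s) hD

/-! ## Flat prior: telescoping, band intervals, assembly -/

/-- Telescoping over a shifted range: `Σ_{t<m} (b(t+s) − b(t)) ≤ s` for `0 ≤ b ≤ 1`. [folklore] -/
theorem rms_sum_range_shift_sub_le (b : ℕ → ℝ) (h0 : ∀ t, 0 ≤ b t) (h1 : ∀ t, b t ≤ 1) (m : ℕ) :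
    ∀ s : ℕ, ∑ t ∈ range m, (b (t + s) - b t) ≤ s := by
  intro s
  induction s with
  | zero => simp
  | succ s ih =>
    have hsplit : ∀ t, b (t + (s + 1)) - b t = (b (t + 1 + s) - b (t + s)) + (b (t + s) - b t) :=
      fun t => by rw [show t + (s + 1) = t + 1 + s by omega]; ring
    rw [sum_congr rfl fun t _ => hsplit t, sum_add_distrib, sum_range_sub (fun t => b (t + s)) m]
    push_cast
    linarith [h1 (m + s), h0 (0 + s)]

/-- **Flat prior.** For any `a : ℕ → [0,1]`, `Σ_{i ∈ [L,U]} (a(i+s) − a(i)) ≤ s`. [folklore] -/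
theorem rms_sum_Icc_shift_sub_le (a : ℕ → ℝ) (h0 : ∀ t, 0 ≤ a t) (h1 : ∀ t, a t ≤ 1)
    (L U s : ℕ) : ∑ i ∈ Icc L U, (a (i + s) - a i) ≤ s := by
  rw [← Finset.Ico_add_one_right_eq_Icc, sum_Ico_eq_sum_range]
  have := rms_sum_range_shift_sub_le (fun t => a (L + t)) (fun t => h0 _) (fun t => h1 _)
    (U + 1 - L) s
  simpa [add_assoc] using this

/-- **Flat prior (registered sub-goal of the toolkit).** For every `a : ℕ → [0,1]` and every interval,
`Σ_{i ∈ [L,U]} (a(i+s) − a(i)) ≤ s`: the shifted acceptance probabilities of the `2w+1` band slices telescope,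
which is what makes the band ("flat prior") absorb the `C(k,2) − 1` missing edges of a sub-planting. [folklore] -/
theorem rms_flatPrior : ∀ a : ℕ → ℝ, (∀ t, 0 ≤ a t) → (∀ t, a t ≤ 1) → ∀ L U s : ℕ, ∑ i ∈ Icc L U, (a (i + s) - a i) ≤ s :=
  fun a h0 h1 L U s => rms_sum_Icc_shift_sub_le a h0 h1 L U s

/-- The lower band `[j−w, j+w−K]` sits inside the band `[j−w, j+w]`. [folklore] -/
theorem rms_Icc_lower_subset (K j w : ℕ) : Icc (j - w) (j + w - K) ⊆ Icc (j - w) (j + w) := by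
  intro i hi
  simp only [mem_Icc] at hi ⊢
  omega

/-- The band exceeds the lower band by at most `K` slices. [folklore] -/
theorem rms_card_Icc_sdiff_le (K j w : ℕ) : #(Icc (j - w) (j + w) \ Icc (j - w) (j + w - K)) ≤ K := by
  have hsub : Icc (j - w) (j + w) \ Icc (j - w) (j + w - K) ⊆ Ioc (j + w - K) (j + w) := by
    intro i hi
    simp only [Finset.mem_sdiff, mem_Icc, mem_Ioc] at hi ⊢
    omega
  calc #(Icc (j - w) (j + w) \ Icc (j - w) (j + w - K)) ≤ #(Ioc (j + w - K) (j + w)) := card_le_card hsub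
    _ ≤ _ := by rw [Nat.card_Ioc]; omega

/-- The lower band has at least `w + 1 − K` slices. [folklore] -/
theorem rms_card_Icc_lower_ge (K j w : ℕ) : w + 1 - K ≤ #(Icc (j - w) (j + w - K)) := by
  rw [Nat.card_Icc]
  omega

/-- **Assembly** of the per-slice bounds over the lower band `I` inside the band `B` (pure real
bookkeeping): per-slice bounds `s − p − K(a' + ε − a) ≤ R`, the flat prior `Σ (a' − a) ≤ K − 1`,
`Σ_B s − K ≤ Σ_I s`, the two hypotheses of `RelMintermPlanted`, `#I ≤ #B`, `2K² ≤ γ·#I` and `Kε = γ/2`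
give `(1/2 − 2γ)·#I ≤ Σ_I R`. [folklore] -/
theorem rms_assemble {I B : Finset ℕ} {K γ ε : ℝ} {R s p a a' : ℕ → ℝ}
    (hper : ∀ i ∈ I, s i - p i - K * (a' i + ε - a i) ≤ R i)
    (htel : ∑ i ∈ I, (a' i - a i) ≤ K - 1)
    (hband : ∑ i ∈ B, s i - K ≤ ∑ i ∈ I, s i)
    (hp : ∑ i ∈ I, p i ≤ γ * #I)
    (hs : (1 / 2 : ℝ) * #B ≤ ∑ i ∈ B, s i)
    (hIB : (#I : ℝ) ≤ #B) (hI : 2 * K ^ 2 ≤ γ * #I) (hKε : K * ε = γ / 2) (hK : 0 ≤ K) :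
    (1 / 2 - 2 * γ) * #I ≤ ∑ i ∈ I, R i := by
  have h1 : ∑ i ∈ I, (s i - p i - K * (a' i + ε - a i)) ≤ ∑ i ∈ I, R i := sum_le_sum hper
  have h2 : ∑ i ∈ I, (s i - p i - K * (a' i + ε - a i)) =
      ∑ i ∈ I, s i - ∑ i ∈ I, p i - K * ∑ i ∈ I, (a' i - a i) - K * ε * #I := by
    have h : ∀ i ∈ I, s i - p i - K * (a' i + ε - a i) = s i - p i - K * (a' i - a i) - K * ε :=
      fun i _ => by ring
    rw [sum_congr rfl h, sum_sub_distrib, sum_sub_distrib, sum_sub_distrib, sum_const, nsmul_eq_mul,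
      ← mul_sum]
    ring
  rw [h2] at h1
  have h3 : K * ∑ i ∈ I, (a' i - a i) ≤ K * (K - 1) := mul_le_mul_of_nonneg_left htel hK
  nlinarith [h1, h3, hband, hp, hs, hIB, hI, hKε]

end Summit.PneNP.PneNP.Cruxes.ConstantBand.FlatPriorRelativeMinterms
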